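import Summits.ABC.IUTFork.Repair.RHSzpiroBadCutFreyResidue
import Summits.ABC.IUTFork.Joshi.ATS4WildBoundLpInitialThetaData
import Literature.IUT.LogVolume.DistinguishedPrimesBound
import HarnessLib

/-!
# R-H row 2 «szpiro-bad-datum-cut», ROUND-2 KERNEL RESIDUE (part 3): the DEGREE-AWARE window criterion
# (`[K : F] ≥ |SL₂(𝔽_l)| = l(l²−1)` for every initial Θ-datum) and the TIGHT Szpiro-bad certificate (`π < 3.15`, common denominator)

PROOF-ONLY file (0 definitions, no instance, no notation) of the abc-iut cell (D-0079 rescue sub-cell R-H, seat abc-iut-rh-typ-2 gen 2); sequel to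
`RHSzpiroBadCutFreyResidue.lean` (p469508) / `RHSzpiroBadCutFreyResidueF18.lean` (p469621). TAKES NO SIDE on [IUTchIII] Cor. 3.12 or on any author.

WHY. Part 1's `l`-sharp window criterion uses NO information on `[K:ℚ]` (`log_p [K:ℚ] ≥ 0`) and therefore certifies the window (¬deep) only for
bad heights `h_v ≤ 8l(2l+3)/((l−3)(l+1))·e_v` (`≈ 21.5` at `l = 13`): among the 133 Szpiro-bad Frey data of R-W's WINDOW-TABLE this covers few
(e.g. F18 @ 11/13, the Reyssat triple @ 13). But the field `K` of an initial Θ-datum is cut out by the kernel of `G_F → GL₂(𝔽_l)` whose image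
`⊇ SL₂(𝔽_l)` ([IUTchI] Def. 3.1 (c)), so `[K : ℚ] ≥ [K : F] ≥ |SL₂(𝔽_l)| = l(l²−1)` — abc-iut block E's
`Summit.ABC.IUTFork.Joshi.ATS4.card_SL_le_finrank_of_initialThetaData` (from `imageContainsSL2` + `range_K_iff`, Krull; landed). Feeding
`log_p [K:ℚ] ≥ k_p` whenever `p^{k_p} ≤ l(l²−1)` into the degree form raises the window constant at a place over `p` to
`8l((l+1)(k_p+2)+1)/((l−3)(l+1))` (`l = 13`: `83.9` at `p = 3`, `42.3` at `p = 23`; `l = 17`, `p = 3`: `88.0`): by the seat's desk scan (k1/scan2.py)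
EVERY one of the 133 Szpiro-bad Frey data of the table then sits in the window at every bad odd place — this file gives the KERNEL criterion;
instances follow in part 4.

* §1 `one_le_depthProduct_of_le_logb` (packet arithmetic with `k ≤ log_p[K:ℚ]`: exponent `≥ A_i − (−o)·i(i+2)/(2le) ≥ 0`, `A_i = (i+2)(4+2k)+1`, from
  `A_i(l−3)(l+1) − 4i(i+2)((l+1)(k+2)+1) = A_i x² + (4(i+2)²(k+2) + 4i + 4) x`, `x = l − 2i − 3 ≥ 0`); `card_SL_le_finrank_rat_of_initialThetaData`,
  `natCast_le_logb_finrank_of_pow_le`; `not_deepOrd_of_neg_ord_jE_mul_le_of_pow_le` / `not_deep_of_neg_ord_jE_mul_le_of_pow_le` (datum forms: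
  per bad place `x₀ | p`, `(−ord_{x₀} j_E)(l−3)(l+1) ≤ 8l((l+1)(k_p+2)+1)·e_{x₀}` with `p^{k_p} ≤ l(l²−1)` ⟹ ¬DeepOrd / ¬Deep);
  `neg_ord_jE_mul_le_of_forall_localHeight_mul_le_residueChar` (cross-field identification with a residue-characteristic-dependent constant);
  **`not_deep_of_forall_localHeight_mul_le_of_pow_le`** (point form: every bad `v` of `F_tpd` with
  `h_v(l−3)(l+1) ≤ 8l((l+1)(k_{p_v}+2)+1)·e_v`, `p^{k_p} ≤ l(l²−1)` ⟹ EVERY Θ-volume datum at `(P, l)` satisfies the window guard VERBATIM).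
* §2 `residueChar_rat_eq_natGenerator`; `localHeight_mul_le_ratPoint_of_factorisation_residueChar` (the §1 hypothesis at a rational point from the
  factorised pole divisor); **`szpiroBad_ratPoint_of_certificate_tight`** — the Szpiro-bad disjunction of p450130 at `(ratPoint q, l)` from ONE inequality
  of natural numbers `(∏_{I∖{l}} p)^A · 63^B < 20^B · ∏_{I∖{l}} p^{C·e_p}` with `6(l+1)(l−1)·C ≤ A(l+4)(l−3)`, `6l(l+5)·C ≤ B(l+4)(l−3)`, `0 < C`
  (`π < 3.15 = 63/20`, Mathlib `Real.pi_lt_d2`; part 1's certificate is the case `C = 1` with `π < 4`) — tight enough for the Reyssat triple at `l = 13`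
  (R-W margin `−0.333`; `C = 15, A = 89, B = 124`).
HONEST FRAMING: hypotheses / predicates, never asserted; NOTHING here asserts that abc is proved or refuted, that Θ-data exist, or takes a side on
[IUTchIII] Cor. 3.12 or on any author; typed ≠ proved; refuted-as-typed ≠ refuted-in-print.
[cite: Mochizuki2012, IUTchI Def. 3.1 (b)(c) p. 61–62; IUTchIII Cor. 3.12 p. 173–174; IUTchIV Prop. 1.2 (i) p. 10, Thm. 1.10 p. 22–24, Cor. 2.2 (ii) proof p. 45–46]
[cite: MochizukiGenEll2010, Def. 3.3 p. 12] [cite: DupuyHilado2025, §3.3, §3.4] [claim: Mochizuki2012, status: disputed] for every IUT locution. Axioms: standard.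
-/

noncomputable section

open Set Function NumberField IsDedekindDomain
open scoped Pointwise

namespace Summit.ABC.IUTFork.Repair.RHSzpiroBadCutFreyResidue

open Thm311 Thm311.Real Cor312 Cor312Vol Cor312Prov Literature.IUT.LogThetaLattice Literature.IUT.LogVolume
  Literature.IUT.HodgeTheaters Literature.IUT.LogVolume.ThetaData Literature.AnabelianGeometry.AbsoluteAnabelian
open Literature.NumberTheory.DiophantineGeometry.GenEll Summit.ABC.IUTFork.Conditional
open Summit.ABC.IUTFork.Repair.RHSzpiroBadCut Summit.ABC.IUTFork.Joshi.ATS4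

/-! ## §1. The degree-aware window criterion -/

/-- **Packet arithmetic with a degree floor.** For `p > 1`, `k ≤ L` (`k : ℕ`; in use `L = log_p [K:ℚ]`), `e ≥ 0`, `l ≥ 5`, an integer `o` with
`(−o)·(l−3)(l+1) ≤ 8l((l+1)(k+2)+1)·e` and a label index `i` with `2i+3 ≤ l`: `p^{((i+2)(4+2L))+1}·(p^{o/(2l·e)})^{(i+1)²−1} ≥ 1`. The case `k = 0` is
part 1's `one_le_depthProduct_of_neg_mul_le`. [folklore] -/
theorem one_le_depthProduct_of_le_logb {p L e : ℝ} {o : ℤ} {i lN k : ℕ} (hp : 1 < p) (hk : (k : ℝ) ≤ L) (he : 0 ≤ e) (h5 : 5 ≤ lN)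
    (ho : (-(o : ℝ)) * (((lN : ℝ) - 3) * ((lN : ℝ) + 1)) ≤ 8 * (lN : ℝ) * (((lN : ℝ) + 1) * ((k : ℝ) + 2) + 1) * e)
    (hil : 2 * (i : ℝ) + 3 ≤ (lN : ℝ)) :
    1 ≤ p ^ ((((i : ℕ) : ℝ) + 2) * (4 + 2 * L) + 1) * (p ^ ((o : ℝ) / (2 * (lN : ℝ) * e))) ^ (((i : ℕ) + 1) ^ 2 - 1) := by
  have hp0 : 0 < p := by linarith
  have hl5 : (5 : ℝ) ≤ lN := by exact_mod_cast h5
  have hi0 : (0 : ℝ) ≤ i := Nat.cast_nonneg _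
  have hk0 : (0 : ℝ) ≤ k := Nat.cast_nonneg _
  have hn : ((((i : ℕ) + 1) ^ 2 - 1 : ℕ) : ℝ) = ((i : ℝ) + 1) ^ 2 - 1 := by
    rw [Nat.cast_sub (Nat.one_le_pow _ _ (Nat.succ_pos _))]
    push_cast
    ring
  rw [← Real.rpow_natCast (p ^ ((o : ℝ) / (2 * (lN : ℝ) * e))) (((i : ℕ) + 1) ^ 2 - 1),
    ← Real.rpow_mul hp0.le, ← Real.rpow_add hp0, hn]
  refine Real.one_le_rpow hp.le ?_
  have hA : ((i : ℝ) + 2) * (4 + 2 * (k : ℝ)) + 1 ≤ (((i : ℕ) : ℝ) + 2) * (4 + 2 * L) + 1 := by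
    nlinarith [Nat.cast_nonneg (α := ℝ) i]
  have hB : -(((i : ℝ) + 2) * (4 + 2 * (k : ℝ)) + 1) ≤ (o : ℝ) / (2 * (lN : ℝ) * e) * (((i : ℝ) + 1) ^ 2 - 1) := by
    have hn0 : (0 : ℝ) ≤ ((i : ℝ) + 1) ^ 2 - 1 := by nlinarith
    have hM : (0 : ℝ) < ((lN : ℝ) - 3) * ((lN : ℝ) + 1) := by nlinarith
    have hApos : (0 : ℝ) < ((i : ℝ) + 2) * (4 + 2 * (k : ℝ)) + 1 := by positivity
    rcases he.eq_or_lt with he0 | he0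
    · rw [← he0, mul_zero, div_zero, zero_mul]
      linarith
    by_cases hoo : (0 : ℝ) ≤ (o : ℝ)
    · have : 0 ≤ (o : ℝ) / (2 * (lN : ℝ) * e) * (((i : ℝ) + 1) ^ 2 - 1) :=
        mul_nonneg (div_nonneg hoo (by positivity)) hn0
      linarith
    push Not at hoo
    have hF : 4 * ((i : ℝ) * ((i : ℝ) + 2)) * (((lN : ℝ) + 1) * ((k : ℝ) + 2) + 1) ≤
        (((i : ℝ) + 2) * (4 + 2 * (k : ℝ)) + 1) * (((lN : ℝ) - 3) * ((lN : ℝ) + 1)) := by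
      have hx0 : 0 ≤ (lN : ℝ) - (2 * (i : ℝ) + 3) := by linarith
      have e1 : (((i : ℝ) + 2) * (4 + 2 * (k : ℝ)) + 1) * (((lN : ℝ) - 3) * ((lN : ℝ) + 1))
          - 4 * ((i : ℝ) * ((i : ℝ) + 2)) * (((lN : ℝ) + 1) * ((k : ℝ) + 2) + 1)
          = (((i : ℝ) + 2) * (4 + 2 * (k : ℝ)) + 1) * ((lN : ℝ) - (2 * (i : ℝ) + 3)) ^ 2
            + (4 * ((i : ℝ) + 2) ^ 2 * ((k : ℝ) + 2) + 4 * (i : ℝ) + 4) * ((lN : ℝ) - (2 * (i : ℝ) + 3)) := by ring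
      nlinarith [mul_nonneg hApos.le (sq_nonneg ((lN : ℝ) - (2 * (i : ℝ) + 3))),
        mul_nonneg (by positivity : (0 : ℝ) ≤ 4 * ((i : ℝ) + 2) ^ 2 * ((k : ℝ) + 2) + 4 * (i : ℝ) + 4) hx0]
    have h1 : (-(o : ℝ)) * ((i : ℝ) * ((i : ℝ) + 2)) * (((lN : ℝ) - 3) * ((lN : ℝ) + 1)) ≤
        2 * (lN : ℝ) * e * (((i : ℝ) + 2) * (4 + 2 * (k : ℝ)) + 1) * (((lN : ℝ) - 3) * ((lN : ℝ) + 1)) := by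
      have hii : (0 : ℝ) ≤ (i : ℝ) * ((i : ℝ) + 2) := by positivity
      calc (-(o : ℝ)) * ((i : ℝ) * ((i : ℝ) + 2)) * (((lN : ℝ) - 3) * ((lN : ℝ) + 1))
          = ((i : ℝ) * ((i : ℝ) + 2)) * ((-(o : ℝ)) * (((lN : ℝ) - 3) * ((lN : ℝ) + 1))) := by ring
        _ ≤ ((i : ℝ) * ((i : ℝ) + 2)) * (8 * (lN : ℝ) * (((lN : ℝ) + 1) * ((k : ℝ) + 2) + 1) * e) :=
            mul_le_mul_of_nonneg_left ho hii
        _ = (2 * (lN : ℝ) * e) * (4 * ((i : ℝ) * ((i : ℝ) + 2)) * (((lN : ℝ) + 1) * ((k : ℝ) + 2) + 1)) := by ring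
        _ ≤ (2 * (lN : ℝ) * e) * ((((i : ℝ) + 2) * (4 + 2 * (k : ℝ)) + 1) * (((lN : ℝ) - 3) * ((lN : ℝ) + 1))) :=
            mul_le_mul_of_nonneg_left hF (by positivity)
        _ = 2 * (lN : ℝ) * e * (((i : ℝ) + 2) * (4 + 2 * (k : ℝ)) + 1) * (((lN : ℝ) - 3) * ((lN : ℝ) + 1)) := by ring
    have h2 : (-(o : ℝ)) * ((i : ℝ) * ((i : ℝ) + 2)) ≤ 2 * (lN : ℝ) * e * (((i : ℝ) + 2) * (4 + 2 * (k : ℝ)) + 1) :=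
      le_of_mul_le_mul_right h1 hM
    have h2le : (0 : ℝ) < 2 * (lN : ℝ) * e := by positivity
    have hrew : (o : ℝ) / (2 * (lN : ℝ) * e) * (((i : ℝ) + 1) ^ 2 - 1) =
        -((-(o : ℝ)) * ((i : ℝ) * ((i : ℝ) + 2)) / (2 * (lN : ℝ) * e)) := by
      field_simp
      ring
    rw [hrew, neg_le_neg_iff, div_le_iff₀ h2le]
    linarith
  linarith

section PerDatum

variable {F K Fbar : Type} [Field F] [NumberField F] [Field K] [NumberField K] [Algebra F K] [Field Fbar]
  [Algebra F Fbar] [Algebra K Fbar] {E : WeierstrassCurve F} [E.IsElliptic] {l : ℕ} {Pb : BadPlacePredicates K}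
  (D : InitialThetaData F K Fbar E l Pb)

/-- **`[K : ℚ] ≥ l(l²−1)` for the `K` of any initial Θ-datum** ([IUTchI] Def. 3.1 (c): `Gal(K/F) ≅ Im(G_F → GL₂(𝔽_l)) ⊇ SL₂(𝔽_l)`; abc-iut block E's
`card_SL_le_finrank_of_initialThetaData` for `[K:F]`, times `[F:ℚ] ≥ 1`). [cite: Mochizuki2012, IUTchI Def. 3.1 (c) p. 61; IUTchIV Thm. 1.10 proof Step (ii) p. 24]
[claim: Mochizuki2012, status: disputed] -/
theorem card_SL_le_finrank_rat_of_initialThetaData (D : InitialThetaData F K Fbar E l Pb) : l * (l ^ 2 - 1) ≤ Module.finrank ℚ K := by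
  have h1 : l * (l ^ 2 - 1) ≤ Module.finrank F K := card_SL_le_finrank_of_initialThetaData D
  have htower : Module.finrank ℚ F * Module.finrank F K = Module.finrank ℚ K := Module.finrank_mul_finrank ℚ F K
  rw [← htower]
  exact h1.trans (Nat.le_mul_of_pos_left _ Module.finrank_pos)

/-- **`k ≤ log_p [K:ℚ]` from `p^k ≤ l(l²−1)`** for the `K` of an initial Θ-datum (`p > 1`). [claim: Mochizuki2012, status: disputed] -/
theorem natCast_le_logb_finrank_of_pow_le (D : InitialThetaData F K Fbar E l Pb) {p k : ℕ} (hp : 1 < p) (hk : p ^ k ≤ l * (l ^ 2 - 1)) :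
    (k : ℝ) ≤ Real.logb p (Module.finrank ℚ K) := by
  have hd : p ^ k ≤ Module.finrank ℚ K := hk.trans (card_SL_le_finrank_rat_of_initialThetaData D)
  have hp1 : (1 : ℝ) < (p : ℝ) := by exact_mod_cast hp
  have hdpos : (0 : ℝ) < (Module.finrank ℚ K : ℝ) := by exact_mod_cast Module.finrank_pos
  rw [Real.le_logb_iff_rpow_le hp1 hdpos, Real.rpow_natCast]
  exact_mod_cast hd

/-- **DEGREE-AWARE WINDOW criterion, `DeepOrd` form**: for an initial Θ-datum `D` over `K` and exponents `k_p` with `p^{k_p} ≤ l(l²−1)` (so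
`k_p ≤ log_p[K:ℚ]`), if EVERY bad place `x₀ | p` of `K` has `(−ord_{x₀}(j_E))·(l−3)(l+1) ≤ 8l((l+1)(k_p+2)+1)·e_{x₀}`, then the datum-only depth
predicate (RHS of `GenuineK.deep_iff_deepOrd`, VERBATIM) FAILS. [cite: Mochizuki2012, IUTchIV Thm. 1.10 p. 22–24; IUTchIII Cor. 3.12 p. 173–174]
[cite: DupuyHilado2025, §3.3, §3.4] [claim: Mochizuki2012, status: disputed] -/
theorem not_deepOrd_of_neg_ord_jE_mul_le_of_pow_le (k : ℕ → ℕ) (hk : ∀ p : ℕ, 1 < p → p ^ k p ≤ l * (l ^ 2 - 1))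
    (hw : ∀ (pp : Nat.Primes) (x₀ : (thetaIndex (pilotDataOfK D K)).Fibre (.inr pp)),
      haveI : Fact (pp : ℕ).Prime := ⟨pp.2⟩
      placeOf (pilotDataOfK D K) pp.1 x₀ ∈ (pilotDataOfK D K).S →
        (-(ord K (placeOf (pilotDataOfK D K) pp.1 x₀) (algebraMap F K E.j) : ℝ)) * (((l : ℝ) - 3) * ((l : ℝ) + 1)) ≤
          8 * (l : ℝ) * (((l : ℝ) + 1) * ((k pp : ℝ) + 2) + 1) * ramIdx K (placeOf (pilotDataOfK D K) pp.1 x₀)) :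
    ¬ (∃ (pp : Nat.Primes) (_ : 2 < (pp : ℕ)) (i : Fin (thetaIndex (pilotDataOfK D K)).lstar)
        (x₀ : (thetaIndex (pilotDataOfK D K)).Fibre (.inr pp)),
      haveI : Fact (pp : ℕ).Prime := ⟨pp.2⟩
      placeOf (pilotDataOfK D K) pp.1 x₀ ∈ (pilotDataOfK D K).S ∧
      ((pp : ℕ) : ℝ) ^ ((((i : ℕ) : ℝ) + 2) * (4 + 2 * Real.logb (pp : ℕ) (Module.finrank ℚ K)) + 1) *
        (((pp : ℕ) : ℝ) ^ ((ord K (placeOf (pilotDataOfK D K) pp.1 x₀) (algebraMap F K E.j) : ℝ) /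
          (2 * l * ramIdx K (placeOf (pilotDataOfK D K) pp.1 x₀)))) ^ (((i : ℕ) + 1) ^ 2 - 1) < 1) := by
  rintro ⟨pp, hp2, i, x₀, hS, hlt⟩
  haveI : Fact (pp : ℕ).Prime := ⟨pp.2⟩
  have hp1 : (1 : ℝ) < ((pp : ℕ) : ℝ) := by exact_mod_cast pp.2.one_lt
  have hL : ((k pp : ℕ) : ℝ) ≤ Real.logb (pp : ℕ) (Module.finrank ℚ K) :=
    natCast_le_logb_finrank_of_pow_le D pp.2.one_lt (hk pp pp.2.one_lt)
  have he : (0 : ℝ) ≤ (ramIdx K (placeOf (pilotDataOfK D K) pp.1 x₀) : ℝ) := Nat.cast_nonneg _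
  have hi : (i : ℕ) < (pilotDataOfK D K).lstar := i.2
  have hleq : (pilotDataOfK D K).l = 2 * (pilotDataOfK D K).lstar + 1 := (pilotDataOfK D K).l_eq
  have hlK : (pilotDataOfK D K).l = l := pilotDataOfK_l D K
  have hil : 2 * ((i : ℕ) : ℝ) + 3 ≤ (l : ℝ) := by
    have : 2 * (i : ℕ) + 3 ≤ l := by omega
    exact_mod_cast this
  exact absurd hlt (not_lt.mpr (one_le_depthProduct_of_le_logb hp1 hL he D.five_le_l (hw pp x₀ hS) hil))

/-- **The same on the CHOSEN realising q-idele** (`Deep` form of the window guard of `H⋆₂` / `hSHwBad`), by `GenuineK.deep_iff_deepOrd`.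
[claim: Mochizuki2012, status: disputed] [cite: DupuyHilado2025, §3.4] -/
theorem not_deep_of_neg_ord_jE_mul_le_of_pow_le (k : ℕ → ℕ) (hk : ∀ p : ℕ, 1 < p → p ^ k p ≤ l * (l ^ 2 - 1))
    (hw : ∀ (pp : Nat.Primes) (x₀ : (thetaIndex (pilotDataOfK D K)).Fibre (.inr pp)),
      haveI : Fact (pp : ℕ).Prime := ⟨pp.2⟩
      placeOf (pilotDataOfK D K) pp.1 x₀ ∈ (pilotDataOfK D K).S →
        (-(ord K (placeOf (pilotDataOfK D K) pp.1 x₀) (algebraMap F K E.j) : ℝ)) * (((l : ℝ) - 3) * ((l : ℝ) + 1)) ≤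
          8 * (l : ℝ) * (((l : ℝ) + 1) * ((k pp : ℝ) + 2) + 1) * ramIdx K (placeOf (pilotDataOfK D K) pp.1 x₀)) :
    ¬ (∃ (pp : Nat.Primes) (_ : 2 < (pp : ℕ)) (i : Fin (thetaIndex (pilotDataOfK D K)).lstar)
        (x₀ : (thetaIndex (pilotDataOfK D K)).Fibre (.inr pp)),
      haveI : Fact (pp : ℕ).Prime := ⟨pp.2⟩
      ((pp : ℕ) : ℝ) ^ ((((i : ℕ) : ℝ) + 2) * (4 + 2 * Real.logb (pp : ℕ) (Module.finrank ℚ K)) + 1) *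
        ‖(exists_realising_qIdeles_pilotDataOfK D).choose pp x₀‖ ^ (((i : ℕ) + 1) ^ 2 - 1) < 1) :=
  fun h => not_deepOrd_of_neg_ord_jE_mul_le_of_pow_le D k hk hw ((GenuineK.deep_iff_deepOrd D).mp h)

/-- **The cross-field identification with a residue-characteristic-dependent constant**: along `F_tpd ⊆ F ⊆ K` with `j(E_F) = j(λ)`, if every bad place
`v` of `F_tpd` has `h_v·M ≤ c(p_v)·e_v` (`M ≥ 0`, `c ≥ 0`), then every finite place `x₀` of `K` has `(−ord_{x₀}(j_E))·M ≤ c(p_{x₀})·e_{x₀}` (`p_{x₀} = p_v` for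
`v` below `x₀`, `residueChar_finBelow`). [cite: Mochizuki2012, IUTchI Def. 3.1 (b)(c) p. 61] [claim: Mochizuki2012, status: disputed] -/
theorem neg_ord_jE_mul_le_of_forall_localHeight_mul_le_residueChar {P : NFPoint} [Algebra P.F F]
    (hj : E.j = algebraMap P.F F (Cor22.jInv P.x)) {M : ℝ} (hM : 0 ≤ M) (c : ℕ → ℝ) (hc : ∀ p, 0 ≤ c p)
    (hw : ∀ v ∈ Cor22.badPlaces P, Cor22.localHeight P v * M ≤ c (residueChar P.F v) * ramIdx P.F v) (x₀ : HeightOneSpectrum (𝓞 K)) :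
    (-(ord K x₀ (algebraMap F K E.j) : ℝ)) * M ≤ c (residueChar K x₀) * ramIdx K x₀ := by
  set v₁ := finBelow F K x₀ with hv₁
  set v₀ := finBelow P.F F v₁ with hv₀
  have hres : residueChar P.F v₀ = residueChar K x₀ := by
    rw [hv₀, hv₁, residueChar_finBelow, residueChar_finBelow]
  have e₁pos : 0 < Ideal.ramificationIdx' v₁.asIdeal x₀.asIdeal := PilotData.ramificationIdx'_finBelow_pos (F := F) x₀
  have e₀pos : 0 < Ideal.ramificationIdx' v₀.asIdeal v₁.asIdeal := PilotData.ramificationIdx'_finBelow_pos (F := P.F) v₁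
  have hord : ord K x₀ (algebraMap F K E.j) =
      (Ideal.ramificationIdx' v₁.asIdeal x₀.asIdeal : ℤ) * ((Ideal.ramificationIdx' v₀.asIdeal v₁.asIdeal : ℤ) *
        ord P.F v₀ (Cor22.jInv P.x)) := by
    rw [hj, ord_algebraMap F K x₀, ord_algebraMap P.F F v₁]
  have hram : (ramIdx K x₀ : ℝ) =
      (ramIdx P.F v₀ : ℝ) * (Ideal.ramificationIdx' v₀.asIdeal v₁.asIdeal : ℝ) * (Ideal.ramificationIdx' v₁.asIdeal x₀.asIdeal : ℝ) := by
    rw [ramIdx_eq_ramIdx_finBelow_mul (F := F) (K := K) x₀, ramIdx_eq_ramIdx_finBelow_mul (F := P.F) (K := F) v₁]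
    push_cast
    ring
  have e₁r : (0 : ℝ) < (Ideal.ramificationIdx' v₁.asIdeal x₀.asIdeal : ℝ) := by exact_mod_cast e₁pos
  have e₀r : (0 : ℝ) < (Ideal.ramificationIdx' v₀.asIdeal v₁.asIdeal : ℝ) := by exact_mod_cast e₀pos
  have hr0 : (0 : ℝ) ≤ (ramIdx P.F v₀ : ℝ) := Nat.cast_nonneg _
  have hprod : (0 : ℝ) ≤ (Ideal.ramificationIdx' v₁.asIdeal x₀.asIdeal : ℝ) * (Ideal.ramificationIdx' v₀.asIdeal v₁.asIdeal : ℝ) :=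
    mul_nonneg e₁r.le e₀r.le
  have hcx : 0 ≤ c (residueChar K x₀) := hc _
  rw [hord, hram, ← hres]
  push_cast
  by_cases hneg : ord P.F v₀ (Cor22.jInv P.x) < 0
  · have hv₀bad : v₀ ∈ Cor22.badPlaces P := (Cor22.mem_badPlaces_iff_ord_neg P v₀).mpr hneg
    have hh := hw v₀ hv₀bad
    rw [Cor22.localHeight_eq_neg_ord hv₀bad] at hh
    have key := mul_le_mul_of_nonneg_left hh hprod
    nlinarith [key]
  · have h0 : (0 : ℝ) ≤ (ord P.F v₀ (Cor22.jInv P.x) : ℝ) := by exact_mod_cast not_lt.mp hneg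
    have hc0 : 0 ≤ c (residueChar P.F v₀) := hc _
    have h1 : (0 : ℝ) ≤ (Ideal.ramificationIdx' v₁.asIdeal x₀.asIdeal : ℝ) * ((Ideal.ramificationIdx' v₀.asIdeal v₁.asIdeal : ℝ) *
        (ord P.F v₀ (Cor22.jInv P.x) : ℝ)) * M := mul_nonneg (mul_nonneg e₁r.le (mul_nonneg e₀r.le h0)) hM
    have h2 : (0 : ℝ) ≤ c (residueChar P.F v₀) * ((ramIdx P.F v₀ : ℝ) * (Ideal.ramificationIdx' v₀.asIdeal v₁.asIdeal : ℝ) *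
        (Ideal.ramificationIdx' v₁.asIdeal x₀.asIdeal : ℝ)) := mul_nonneg hc0 (mul_nonneg (mul_nonneg hr0 e₀r.le) e₁r.le)
    nlinarith

end PerDatum

/-- **DEGREE-AWARE WINDOW-PERMANENCE at a `λ`-line point.** Exponents `k_p` with `p^{k_p} ≤ l(l²−1)` for every `p > 1`; if every bad place `v` of `F_tpd`
has `h_v·(l−3)(l+1) ≤ 8l((l+1)(k_{p_v}+2)+1)·e_v`, then EVERY genuine Θ-volume datum `T` at `(P, l)` satisfies the window guard (¬deep) of `H⋆₂` / of
`hSHwBad` (p450130) VERBATIM: `[K:ℚ] ≥ l(l²−1)` by [IUTchI] Def. 3.1 (c) (`card_SL_le_finrank_of_initialThetaData`), and the residue characteristic of a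
fibre point `x₀ | p` is `p` (`natCast_mem_placeOf`). At a rational point: `max_{v | p} h_v ≤ 8l((l+1)(k_p+2)+1)/((l−3)(l+1))`.
[cite: Mochizuki2012, IUTchIII Cor. 3.12 p. 173–174; IUTchIV Thm. 1.10 p. 22–24; IUTchI Def. 3.1 (c) p. 61] [claim: Mochizuki2012, status: disputed] -/
theorem not_deep_of_forall_localHeight_mul_le_of_pow_le {P : NFPoint} {l : ℕ} (T : Cor22.ThetaVolumeDatumAt P l) (k : ℕ → ℕ)
    (hk : ∀ p : ℕ, 1 < p → p ^ k p ≤ l * (l ^ 2 - 1))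
    (hw : ∀ v ∈ Cor22.badPlaces P, Cor22.localHeight P v * (((l : ℝ) - 3) * ((l : ℝ) + 1)) ≤
      8 * (l : ℝ) * (((l : ℝ) + 1) * ((k (residueChar P.F v) : ℝ) + 2) + 1) * ramIdx P.F v) :
    letI := T.instFieldF; letI := T.instNumberFieldF; letI := T.instAlgebraF; letI := T.instFieldK
    letI := T.instNumberFieldK; letI := T.instAlgebraK; letI := T.instFieldFbar; letI := T.instAlgebraFbar
    letI := T.instAlgebraKFbar; letI := T.instIsElliptic
    ¬ (∃ (pp : Nat.Primes) (_ : 2 < (pp : ℕ)) (i : Fin (thetaIndex (pilotDataOfK T.D T.K)).lstar)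
        (x₀ : (thetaIndex (pilotDataOfK T.D T.K)).Fibre (.inr pp)),
      haveI : Fact (pp : ℕ).Prime := ⟨pp.2⟩
      ((pp : ℕ) : ℝ) ^ ((((i : ℕ) : ℝ) + 2) * (4 + 2 * Real.logb (pp : ℕ) (Module.finrank ℚ T.K)) + 1) *
        ‖(exists_realising_qIdeles_pilotDataOfK T.D).choose pp x₀‖ ^ (((i : ℕ) + 1) ^ 2 - 1) < 1) := by
  letI := T.instFieldF; letI := T.instNumberFieldF; letI := T.instAlgebraF; letI := T.instFieldK
  letI := T.instNumberFieldK; letI := T.instAlgebraK; letI := T.instFieldFbar; letI := T.instAlgebraFbar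
  letI := T.instAlgebraKFbar; letI := T.instIsElliptic
  have h5 : (5 : ℝ) ≤ l := by exact_mod_cast T.D.five_le_l
  have hM : (0 : ℝ) ≤ ((l : ℝ) - 3) * ((l : ℝ) + 1) := by nlinarith
  have hc : ∀ p : ℕ, (0 : ℝ) ≤ 8 * (l : ℝ) * (((l : ℝ) + 1) * ((k p : ℝ) + 2) + 1) := fun p => by positivity
  refine not_deep_of_neg_ord_jE_mul_le_of_pow_le T.D k hk fun pp x₀ _ => ?_
  haveI : Fact (pp : ℕ).Prime := ⟨pp.2⟩
  have hres : residueChar T.K (placeOf (pilotDataOfK T.D T.K) pp.1 x₀) = (pp : ℕ) :=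
    residueChar_eq_of_natCast_mem (pp : ℕ) (natCast_mem_placeOf (pilotDataOfK T.D T.K) pp.1 x₀)
  have h := neg_ord_jE_mul_le_of_forall_localHeight_mul_le_residueChar (K := T.K) T.j_eq hM
    (fun p => 8 * (l : ℝ) * (((l : ℝ) + 1) * ((k p : ℝ) + 2) + 1)) hc hw (placeOf (pilotDataOfK T.D T.K) pp.1 x₀)
  rw [hres] at h
  exact h

/-! ## §2. Rational points: the window hypothesis with exponents, and the TIGHT Szpiro-bad certificate -/

section RatPoint

open Rat.HeightOneSpectrum Literature.NumberTheory.DiophantineGeometry.UniformABCConjecture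

variable {q : ℚ} {N Dn : ℕ} {I : Finset ℕ} {e : ℕ → ℕ}

/-- At a finite place of `ℚ` the residue characteristic is the prime under the place (`p_v = natGenerator v`). [folklore] -/
theorem residueChar_rat_eq_natGenerator (v : HeightOneSpectrum (𝓞 ℚ)) : residueChar ℚ v = natGenerator v := by
  haveI : Fact (natGenerator v).Prime := ⟨prime_natGenerator v⟩
  exact residueChar_eq_of_natCast_mem (natGenerator v) ((natCast_mem_asIdeal_iff v (natGenerator v)).2 dvd_rfl)

/-- **The degree-aware window hypothesis at a rational point from the factorised pole divisor**: if `e_p·M ≤ c(p)` for every `p ∈ I` (`c ≥ 0`), then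
every bad place `v` of `ratPoint q` has `h_v·M ≤ c(p_v)·e_v`. [cite: MochizukiGenEll2010, Def. 3.3 p. 12] [claim: Mochizuki2012, status: disputed] -/
theorem localHeight_mul_le_ratPoint_of_factorisation_residueChar (hI : ∀ p ∈ I, p.Prime) (hD : Dn = ∏ p ∈ I, p ^ e p)
    (hj : Cor22.jInv q = (N : ℚ) / (Dn : ℚ)) (hN : N ≠ 0) (hcop : ∀ p ∈ I, ¬ p ∣ N) {M : ℝ} (c : ℕ → ℝ) (hc : ∀ p, 0 ≤ c p)
    (hle : ∀ p ∈ I, (e p : ℝ) * M ≤ c p) :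
    ∀ v : HeightOneSpectrum (𝓞 ℚ), v ∈ Cor22.badPlaces (ratPoint q) →
      Cor22.localHeight (ratPoint q) v * M ≤ c (residueChar ℚ v) * ramIdx ℚ v := by
  intro v hv
  have hneg : ord ℚ v (Cor22.jInv q) < 0 := (Cor22.mem_badPlaces_iff_ord_neg (ratPoint q) v).1 hv
  have hmem : natGenerator v ∈ I := by
    by_contra h
    exact absurd hneg (not_lt.mpr (Cor22.ord_jInv_ratPoint_nonneg_of_not_mem hI hD hj hN v h))
  rw [Cor22.localHeight_ratPoint_eq hI hD hj hN v hmem (hcop _ hmem), residueChar_rat_eq_natGenerator]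
  have h1 : (1 : ℝ) ≤ (ramIdx ℚ v : ℝ) := by
    exact_mod_cast Nat.one_le_iff_ne_zero.mpr (ramIdx_ne_zero ℚ v)
  calc (e (natGenerator v) : ℝ) * M ≤ c (natGenerator v) := hle _ hmem
    _ = c (natGenerator v) * 1 := (mul_one _).symm
    _ ≤ c (natGenerator v) * ramIdx ℚ v := mul_le_mul_of_nonneg_left h1 (hc _)

/-- The real arithmetic of the TIGHT certificate: `l ≥ 5`, `C > 0`, `6(l+1)(l−1)C ≤ A(l+4)(l−3)`, `6l(l+5)C ≤ B(l+4)(l−3)`, `S₁ ≥ 0`, `0 ≤ L_π ≤ L₆₃ − L₂₀`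
and `A·S₁ + B·L₆₃ < B·L₂₀ + C·S₂` ⟹ `6l(l+5−4)/((l+4)(l−3))·(0 + (1−1/l)S₁) + 6l(l+5)/((l+4)(l−3))·L_π < S₂`. [folklore] -/
theorem szpiroBad_arith_tight {l A B C S₁ S₂ Lπ L63 L20 : ℝ} (hl5 : 5 ≤ l) (hC : 0 < C)
    (hA : 6 * (l + 1) * (l - 1) * C ≤ A * ((l + 4) * (l - 3))) (hB : 6 * l * (l + 5) * C ≤ B * ((l + 4) * (l - 3)))
    (hS1 : 0 ≤ S₁) (hLπ0 : 0 ≤ Lπ) (hLπ : Lπ ≤ L63 - L20) (key : A * S₁ + B * L63 < B * L20 + C * S₂) :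
    6 * l * ((l + 5) - 4 * 1) / ((l + 4) * (l - 3)) * (0 + (1 - 1 / l) * S₁) + 6 * l * (l + 5) / ((l + 4) * (l - 3)) * Lπ < S₂ := by
  have hM : 0 < (l + 4) * (l - 3) := by nlinarith
  have hl0 : 0 < l := by linarith
  have hB0 : 0 ≤ B := by
    have : 0 < 6 * l * (l + 5) * C := by positivity
    nlinarith
  have hcoef1 : 6 * l * ((l + 5) - 4 * 1) / ((l + 4) * (l - 3)) * (1 - 1 / l) * C ≤ A := by
    rw [div_mul_eq_mul_div, div_mul_eq_mul_div, div_le_iff₀ hM]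
    have e1 : 6 * l * ((l + 5) - 4 * 1) * (1 - 1 / l) * C = 6 * (l + 1) * (l - 1) * C := by
      field_simp
      ring
    rw [e1]
    exact hA
  have hcoef2 : 6 * l * (l + 5) / ((l + 4) * (l - 3)) * C ≤ B := by
    rw [div_mul_eq_mul_div, div_le_iff₀ hM]
    exact hB
  -- multiply the goal by `C`
  have h1 : C * (6 * l * ((l + 5) - 4 * 1) / ((l + 4) * (l - 3)) * (0 + (1 - 1 / l) * S₁)) ≤ A * S₁ := by
    rw [zero_add]
    calc C * (6 * l * ((l + 5) - 4 * 1) / ((l + 4) * (l - 3)) * ((1 - 1 / l) * S₁))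
        = (6 * l * ((l + 5) - 4 * 1) / ((l + 4) * (l - 3)) * (1 - 1 / l) * C) * S₁ := by ring
      _ ≤ A * S₁ := mul_le_mul_of_nonneg_right hcoef1 hS1
  have h2 : C * (6 * l * (l + 5) / ((l + 4) * (l - 3)) * Lπ) ≤ B * (L63 - L20) := by
    calc C * (6 * l * (l + 5) / ((l + 4) * (l - 3)) * Lπ)
        = (6 * l * (l + 5) / ((l + 4) * (l - 3)) * C) * Lπ := by ring
      _ ≤ B * Lπ := mul_le_mul_of_nonneg_right hcoef2 hLπ0
      _ ≤ B * (L63 - L20) := mul_le_mul_of_nonneg_left hLπ hB0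
  have h3 : C * (6 * l * ((l + 5) - 4 * 1) / ((l + 4) * (l - 3)) * (0 + (1 - 1 / l) * S₁) +
      6 * l * (l + 5) / ((l + 4) * (l - 3)) * Lπ) < C * S₂ := by
    rw [mul_add]
    linarith
  exact lt_of_mul_lt_mul_left h3 hC.le

/-- **THE TIGHT SZPIRO-BAD CERTIFICATE at a rational point.** `j(q) = N/∏_{p∈I} p^{e_p}` with `I` odd primes, `e_p ≥ 1`, `p ∤ N` on `I`; `l ≥ 5` prime;
naturals `A, B, C` with `C > 0`, `6(l+1)(l−1)·C ≤ A(l+4)(l−3)`, `6l(l+5)·C ≤ B(l+4)(l−3)`; and ONE inequality of natural numbers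
`(∏_{p∈I∖{l}} p)^A · 63^B < 20^B · ∏_{p∈I∖{l}} p^{C·e_p}`. THEN the Szpiro-bad disjunction of the cut certificate p450130 (the extra antecedent of `H⋆₂`,
`hSHwBad`, `hNumBad`) HOLDS at `(ratPoint q, l)` (`d_mod = 1`, `log-diff = 0`, exact `log q^{∤2l}` / `log 𝔣^{∤2l}` sums of abc-iut-c312-d1's dictionary,
`π < 3.15 = 63/20`). [cite: Mochizuki2012, IUTchIV Thm. 1.10 p. 22–23, Cor. 2.2 (ii) proof p. 46] [claim: Mochizuki2012, status: disputed] -/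
theorem szpiroBad_ratPoint_of_certificate_tight (hI : ∀ p ∈ I, p.Prime) (he : ∀ p ∈ I, e p ≠ 0) (hD : Dn = ∏ p ∈ I, p ^ e p)
    (hj : Cor22.jInv q = (N : ℚ) / (Dn : ℚ)) (hN : N ≠ 0) (hcop : ∀ p ∈ I, ¬ p ∣ N) (h2 : 2 ∉ I) {l : ℕ} (hl : l.Prime)
    (h5 : 5 ≤ l) {A B C : ℕ} (hC : 0 < C) (hA : 6 * ((l : ℝ) + 1) * ((l : ℝ) - 1) * C ≤ A * (((l : ℝ) + 4) * ((l : ℝ) - 3)))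
    (hB : 6 * (l : ℝ) * ((l : ℝ) + 5) * C ≤ B * (((l : ℝ) + 4) * ((l : ℝ) - 3)))
    (hcert : (∏ p ∈ I.erase l, p) ^ A * 63 ^ B < 20 ^ B * ∏ p ∈ I.erase l, p ^ (C * e p)) :
    ((l : ℝ) + 5) / 4 < (Cor22.dmod (ratPoint q) : ℝ) ∨
      6 * l * (((l : ℝ) + 5) - 4 * Cor22.dmod (ratPoint q)) / (((l : ℝ) + 4) * ((l : ℝ) - 3))
          * ((ratPoint q).logDiff + (1 - 1 / (l : ℝ)) * Cor22.logCondAvoid (ratPoint q) {2, l})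
        + 6 * l * ((l : ℝ) + 5) / (((l : ℝ) + 4) * ((l : ℝ) - 3)) * Real.log Real.pi < Cor22.logQAvoid (ratPoint q) {2, l} := by
  right
  have hd : Cor22.dmod (ratPoint q) = 1 := Cor22.dmod_eq_one_of_degree_le_one (le_of_eq (degree_ratPoint q))
  rw [hd, logDiff_ratPoint, Cor22.logCondAvoid_ratPoint_two_prime_eq_sum hI he hD hj hN hcop h2 hl,
    Cor22.logQAvoid_ratPoint_two_prime_eq_sum hI he hD hj hN hcop h2 hl, Nat.cast_one]
  have hl5 : (5 : ℝ) ≤ l := by exact_mod_cast h5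
  have hCr : (0 : ℝ) < (C : ℝ) := by exact_mod_cast hC
  have hJ : ∀ p ∈ I.erase l, (0 : ℝ) < p := fun p hp => by
    exact_mod_cast (hI p (Finset.mem_of_mem_erase hp)).pos
  have hS1 : 0 ≤ ∑ p ∈ I.erase l, Real.log (p : ℝ) :=
    Finset.sum_nonneg fun p hp => Real.log_nonneg (by exact_mod_cast (hI p (Finset.mem_of_mem_erase hp)).one_lt.le)
  have hlogpi : Real.log Real.pi ≤ Real.log 63 - Real.log 20 := by
    rw [← Real.log_div (by norm_num) (by norm_num)]
    exact Real.log_le_log Real.pi_pos (by have := Real.pi_lt_d2; norm_num at this ⊢; linarith)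
  have hlogpi0 : 0 ≤ Real.log Real.pi := Real.log_nonneg (by linarith [Real.pi_gt_three])
  have key : (A : ℝ) * (∑ p ∈ I.erase l, Real.log (p : ℝ)) + B * Real.log 63 <
      B * Real.log 20 + C * ∑ p ∈ I.erase l, (e p : ℝ) * Real.log (p : ℝ) := by
    have hprod : (0 : ℝ) < ∏ p ∈ I.erase l, (p : ℝ) := Finset.prod_pos hJ
    have hlhs : (0 : ℝ) < (∏ p ∈ I.erase l, (p : ℝ)) ^ A * 63 ^ B := by positivity
    have hcast : (((∏ p ∈ I.erase l, p) ^ A * 63 ^ B : ℕ) : ℝ) < ((20 ^ B * ∏ p ∈ I.erase l, p ^ (C * e p) : ℕ) : ℝ) := by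
      exact_mod_cast hcert
    push_cast at hcast
    have hlog := Real.log_lt_log hlhs hcast
    rw [Real.log_mul (pow_pos hprod _).ne' (by positivity), Real.log_pow, Real.log_pow,
      Real.log_mul (by positivity) (Finset.prod_pos fun p hp => pow_pos (hJ p hp) _).ne', Real.log_pow,
      Real.log_prod (fun p hp => (hJ p hp).ne'), Real.log_prod (fun p hp => (pow_pos (hJ p hp) _).ne')] at hlog
    have hsum : ∑ p ∈ I.erase l, Real.log ((p : ℝ) ^ (C * e p)) = C * ∑ p ∈ I.erase l, (e p : ℝ) * Real.log (p : ℝ) := by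
      rw [Finset.mul_sum]
      refine Finset.sum_congr rfl fun p _ => ?_
      rw [Real.log_pow]
      push_cast
      ring
    rw [hsum] at hlog
    exact hlog
  exact szpiroBad_arith_tight hl5 hCr hA hB hS1 hlogpi0 hlogpi key

end RatPoint

end Summit.ABC.IUTFork.Repair.RHSzpiroBadCutFreyResidue

end
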